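import Summits.Ventures.GridStability.Lyapunov.PolyRecastBernstein
import HarnessLib

/-!
# GridStability/Lyapunov/PolyRecastBernsteinCoeffs — the KERNEL computes the tensor-Bernstein coefficients itself:
# `bernCoeffs p d lo hi`, so a box enclosure is ONE `decide` on box literals only (no coefficient data in the rider)

Cell `gridfusion` (LADDER-GRIDFUSION), `plan/PARTITION.md` §0 row `Lyapunov/`; seat gridfusion-lyap-2 (g6), declared INSTRUMENT line
«T1-KERNEL · BERN» (lead g8 RULING 9bo (1)); companion of `PolyRecastBernstein.lean` (same namespace
`Summit.Ventures.GridStability.Lyapunov.PolyRecast`). There the coefficient list `b` of the tensor Bernstein form is caller DATA,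
re-verified by the representation check `bernRep`. For a 3-variable sextic that is 343 long rationals PER BOX — too much text for a
rider file with 16 boxes. Here the kernel derives the list from `p` and the box by the classical power → Bernstein conversion
(Garloff 1986 §2, eq. (4)–(6): substitute `x_i = lo_i + (hi_i − lo_i) t_i`, then on each axis
`t^k = Σ_{j ≥ k} [C(j,k)/C(d,k)] B_{d,j}(t)`), so a rider decides
`bernUpper p d lo hi (bernCoeffs p d lo hi) M` from the literals `d, lo, hi, M` alone — the same shape as `absBox … ≤ c` of
`PolyRecastBox.lean` (p536818), with sign cancellation between monomials now accounted for.

NO SOUNDNESS CLAIM IS NEEDED (or made) for the conversion: `bernUpper` re-expands the form with the computed coefficients and checks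
the identity with `p` (`bernRep`); were `bernCoeffs` wrong, the check would fail, never pass. The theorems below are the
specialisations of `eval_le_of_bernUpper` / `le_eval_of_bernLower` to `b := bernCoeffs p d lo hi`, for citation by name.

* `monoGet`, `monoSet` — read / write one exponent of a dense exponent vector (zero padding, trimmed result);
* `bernShiftMono`, `bernPairUp`, `bernMergeAll`, `bernShift` — balanced summation and the affine substitution `x_i ↦ lo_i + (hi_i − lo_i)·t_i` of a monomial / a `Poly` (as a `Poly` in `t`);
* `bernLift`, `bernAxis`, `bernAxes` — power → Bernstein conversion one axis at a time on the term list
  (`(I, a) ↦ Σ_{j ≤ d_i} (I[i ↦ j], a·C(j,I_i)/C(d_i,I_i))`, zero terms dropped);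
* `bernLookup`, `bernCat`, `bernDense` — densify the sparse coefficient list into the flat lexicographic layout (first variable
  slowest) read by `bernForm`;
* `bernCoeffs p d lo hi` — the composite; `eval_le_of_bernCoeffs` / `le_eval_of_bernCoeffs` — the enclosure by ONE decide.

Cost (kernel, measured on tree literals in the test section's shape): dominated by the conversion, `O(n · Π(d_i+1) · max(d_i+1))`
term insertions plus `O(Π(d_i+1) · |terms|)` exponent-vector comparisons for the densification. Pure bookkeeping: standard axioms,
no named fact, computation-oriented `def`s only. [cite: Garloff1986, §2]
-/

open Literature.Computation.Certificates Literature.Computation.Certificates.SOS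

namespace Summit.Ventures.GridStability.Lyapunov.PolyRecast

/-! ### Exponent vectors -/

/-- Read the exponent of variable `i` in a dense exponent vector (zero past the end). [folklore] -/
def monoGet : Monomial → ℕ → ℕ
  | [], _ => 0
  | e :: _, 0 => e
  | _ :: es, i + 1 => monoGet es i

/-- Write the exponent of variable `i` (padding with zeros), WITHOUT trimming. [folklore] -/
def monoSetRaw : Monomial → ℕ → ℕ → Monomial
  | [], 0, v => [v]
  | [], i + 1, v => 0 :: monoSetRaw [] i v
  | _ :: es, 0, v => v :: es
  | e :: es, i + 1, v => e :: monoSetRaw es i v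

/-- Write the exponent of variable `i` and trim trailing zeros (canonical exponent vector). [folklore] -/
def monoSet (m : Monomial) (i v : ℕ) : Monomial := Monomial.trim (monoSetRaw m i v)

/-! ### Affine substitution into the unit box -/

/-- Substitute `x_i ↦ lo_i + (hi_i − lo_i)·t_i` in the exponent vector `m` read from variable index `k`; result as a `Poly` in
`t`. [cite: Garloff1986, §2] -/
def bernShiftMono (lo hi : ℕ → ℚ) : ℕ → Monomial → Poly
  | _, [] => Poly.C 1
  | k, e :: es =>
      Poly.mul (bernPow (Poly.add (bernC (lo k)) (Poly.smul (hi k - lo k) (Poly.X k))) e) (bernShiftMono lo hi (k + 1) es)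

/-- One round of pairwise `Poly.add` on a list of polynomials. [folklore] -/
def bernPairUp : List Poly → List Poly
  | p :: q :: rest => Poly.add p q :: bernPairUp rest
  | l => l

/-- Balanced sum of a list of polynomials (pairwise rounds while the fuel lasts, then a right fold): like-term merging in
`O(N log N)` instead of the `O(N²)` of repeated insertion. [folklore] -/
def bernMergeAll : ℕ → List Poly → Poly
  | 0, l => l.foldr Poly.add []
  | _ + 1, [] => []
  | _ + 1, [p] => p
  | fuel + 1, p :: q :: rest => bernMergeAll fuel (bernPairUp (p :: q :: rest))

/-- Substitute `x_i ↦ lo_i + (hi_i − lo_i)·t_i` in every term of `p` (power coefficients `a_I` of `p` on the box, as a `Poly`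
in `t`; balanced summation). [cite: Garloff1986, §2] -/
def bernShift (lo hi : ℕ → ℚ) (p : Poly) : Poly :=
  bernMergeAll p.length (p.map fun t => Poly.smul t.2 (bernShiftMono lo hi 0 t.1))

/-! ### Power → Bernstein conversion, axis by axis -/

/-- One term on axis `i` (degree `d`): `(I, a) ↦ Σ_{j < s} (I[i ↦ j], a · C(j, I_i) / C(d, I_i))` (terms with `j < I_i` vanish
since `C(j, I_i) = 0`; zero terms are dropped). [cite: Garloff1986, §2] -/
def bernLift (i d : ℕ) (I : Monomial) (a : ℚ) : ℕ → Poly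
  | 0 => []
  | j + 1 =>
      Poly.add
        (if a * (Nat.choose j (monoGet I i) : ℚ) = 0 then []
         else [(monoSet I i j, a * (Nat.choose j (monoGet I i) : ℚ) / (Nat.choose d (monoGet I i) : ℚ))])
        (bernLift i d I a j)

/-- Convert axis `i` (degree `d`) of a whole term list from the power to the Bernstein basis (balanced summation of the
lifted terms). [cite: Garloff1986, §2] -/
def bernAxis (i d : ℕ) (q : Poly) : Poly :=
  bernMergeAll q.length (q.map fun t => bernLift i d t.1 t.2 (d + 1))

/-- Convert the axes `i, i+1, …` with degrees `d :: ds` in turn. [cite: Garloff1986, §2] -/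
def bernAxes : ℕ → List ℕ → Poly → Poly
  | _, [], q => q
  | i, d :: ds, q => bernAxes (i + 1) ds (bernAxis i d q)

/-! ### Densification into the layout of `bernForm` -/

/-- Coefficient of the (trimmed) multi-index `J` in a sparse coefficient list (`0` if absent). [folklore] -/
def bernLookup (J : Monomial) : Poly → ℚ
  | [] => 0
  | (I, a) :: q => if I = J then a else bernLookup J q

/-- Concatenate `f 0 ++ f 1 ++ ⋯ ++ f (n−1)`. [folklore] -/
def bernCat (f : ℕ → List ℚ) : ℕ → List ℚ
  | 0 => []
  | n + 1 => bernCat f n ++ f n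

/-- The flat coefficient list over the whole grid `Π_i {0, …, d_i}` in lexicographic order (first variable slowest), prefix
`pre` already fixed. [folklore] -/
def bernDense (q : Poly) : List ℕ → Monomial → List ℚ
  | [], pre => [bernLookup (Monomial.trim pre) q]
  | d :: ds, pre => bernCat (fun j => bernDense q ds (pre ++ [j])) (d + 1)

/-- **The tensor-Bernstein coefficients of `p` on the box `Π_{i<|d|} [lo_i, hi_i]` with degree vector `d`**, computed by the
kernel: affine substitution, axis-by-axis basis conversion, densification. No correctness theorem is attached — `bernRep` /
`bernUpper` / `bernLower` re-verify the representation. [cite: Garloff1986, §2] -/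
def bernCoeffs (p : Poly) (d : List ℕ) (lo hi : ℕ → ℚ) : List ℚ :=
  bernDense (bernAxes 0 d (bernShift lo hi p)) d []

/-! ### The enclosure by one decide -/

section Eval

variable {K : Type*} [Field K] [LinearOrder K] [IsStrictOrderedRing K]

/-- **Upper box bound by ONE decide on literals**: `bernUpper p d lo hi (bernCoeffs p d lo hi) M = true` and
`lo_i ≤ x_i ≤ hi_i` (`i < |d|`) ⇒ `p(x) ≤ M`. [cite: Garloff1986, §2] -/
theorem eval_le_of_bernCoeffs {p : Poly} {d : List ℕ} {lo hi : ℕ → ℚ} {M : ℚ}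
    (h : bernUpper p d lo hi (bernCoeffs p d lo hi) M = true) {x : ℕ → K}
    (hx : ∀ i, i < d.length → (lo i : K) ≤ x i ∧ x i ≤ (hi i : K)) :
    Poly.eval x p ≤ (M : K) :=
  eval_le_of_bernUpper h hx

/-- **Lower box bound by ONE decide on literals**: `bernLower p d lo hi (bernCoeffs p d lo hi) m = true` and
`lo_i ≤ x_i ≤ hi_i` (`i < |d|`) ⇒ `m ≤ p(x)`. [cite: Garloff1986, §2] -/
theorem le_eval_of_bernCoeffs {p : Poly} {d : List ℕ} {lo hi : ℕ → ℚ} {m : ℚ}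
    (h : bernLower p d lo hi (bernCoeffs p d lo hi) m = true) {x : ℕ → K}
    (hx : ∀ i, i < d.length → (lo i : K) ≤ x i ∧ x i ≤ (hi i : K)) :
    (m : K) ≤ Poly.eval x p :=
  le_eval_of_bernLower h hx

end Eval

/-! ### Kernel tests -/

/-- Test (kernel): the computed coefficients of `x₀²` on `[−1, 2]` (degree 2) are `[1, −2, 4]`. -/
example : bernCoeffs [(([2] : List ℕ), (1 : ℚ))] [2] (vars [(-1 : ℚ)]) (vars [(2 : ℚ)]) = [1, -2, 4] := by
  decide +kernel

/-- Test (kernel): `x₀ x₁ − x₁²` on `[0, 1] × [0, 2]`, degrees `(1, 2)`: coefficients `[0, 0, −4, 0, 1, −2]`, and the one-decide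
upper test with `M = 1` passes. -/
example : bernUpper [(([1, 1] : List ℕ), (1 : ℚ)), (([0, 2] : List ℕ), (-1 : ℚ))] [1, 2] (vars [(0 : ℚ), 0]) (vars [(1 : ℚ), 2])
    (bernCoeffs [(([1, 1] : List ℕ), (1 : ℚ)), (([0, 2] : List ℕ), (-1 : ℚ))] [1, 2] (vars [(0 : ℚ), 0]) (vars [(1 : ℚ), 2]))
    1 = true := by
  decide +kernel

/-- Test (kernel): a degree vector ABOVE the true degrees is allowed (degree elevation): `x₀²` read with degree 3 on `[0, 1]` has
coefficients `[0, 0, 1/3, 1]`. -/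
example : bernCoeffs [(([2] : List ℕ), (1 : ℚ))] [3] (vars [(0 : ℚ)]) (vars [(1 : ℚ)]) = [0, 0, 1 / 3, 1] := by
  decide +kernel

end Summit.Ventures.GridStability.Lyapunov.PolyRecast
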